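import Mathlib
import Literature.MathematicalPhysics.QuantumFieldTheory.PlaquetteRandomClusterDuality
import Literature.Probability.LatticeModels.RandomCluster
import HarnessLib

/-!
# The dual graph of `𝕋³_L` and Duncan–Schweinhart's Theorem 18 for `(d, i) = (3, 2)`: the
# plaquette random-cluster model in three dimensions is dual to the FK random-cluster model — PROVED

Thirteenth file of the transcription of the Fortuin–Kasteleyn-type ("plaquette random-cluster")
representation of `q`-state Potts lattice gauge theory (companions: `PlaquetteRandomCluster` —
setting, readings (R1)–(R3), (R7) and the SCOPE caveat —, `PlaquetteRandomClusterDuality`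
(Theorem 18 in the "Alexander-dual dictionary", every `d`: dual weight
`dualWeight_{p',q}(ω) = p'^{|ωᶜ|}(1-p')^{|ω|} q^{dim W(ω)}`, `W(ω) = {w ∈ C₃ : ∂₃w ⊥ ωᶜ}`),
`PlaquetteRandomClusterDualityCubical` (the literal cell identification for `d = 4`); and, on the
random-cluster side, `Literature.Probability.LatticeModels.RandomCluster` (`rcWeight`,
`clusterCount` [Grimmett2006, §1.2])).

## Scope (read this first)

Nothing in this file bears on the Clay Yang–Mills mass-gap problem: finite abelian `ℤ_q`, finite
`3`-torus. In the `ym` ladder only the conditional finite-`𝕋⁴` rung `BalabanLadder.UV` is closed by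
any current route; `BalabanLadder.IR` is untouched. The file makes the `d = 3` row of the census
dictionary literal: the graphical (FK) representation of `ℤ_q` lattice gauge theory in three
dimensions IS, by duality, the FK representation of the `q`-state Potts model on the dual lattice.

## Source

P. Duncan, B. Schweinhart, CMP **406** (2025), arXiv:2207.08339 [DuncanSchweinhart2025], §2.2 (the
dual complex: the dual of an `i`-cell of `𝕋^d_N` is a `(d-i)`-cell of the dual torus), §4.3 (`ω•`,
`p*`) and **Theorem 18** [corpus:paper:arxiv-2207.08339 p0015 L35]: "the balanced plaquette
random-cluster model satisfies `μ̃_{𝕋^d_N,p,q,i}(P) =^d μ̃_{𝕋^d_N,p*,q,d-i}(P•)`" — for `d = 3`,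
`i = 2` the dual model is the `1`-dimensional plaquette random-cluster model, i.e. the (bond) FK
random-cluster model with cluster weight `q^{#clusters}`.

## What is typed (transcriber's coordinates, flagged)

Label the dual site (cube) `x + (½,½,½)` by `x`. The dual cell of the plaquette `(z; a<b)` is the
bond `dualEdge σ = s(z - e_c, z)` between the two cubes it separates (`c = Dual3.complDir a b` the
normal direction); `dualBonds ω = {dualEdge σ : σ ∉ ω}`; `dualGraph` = the graph of all dual edges
(the nearest-neighbour `3`-torus on the cubes). PROVED: `bd₃_apply_three` (`∂₃` on `𝕋³_L` in
coordinates), `mem_dualCocycles_three` (`w ∈ W(ω)` iff `w` is constant across every closed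
plaquette), `dualEdge_injective` (needs `L ≥ 3`: for `L = 2` the torus graph has double bonds and
the simple-graph dual fails; for `L = 1` loops), `card_dualBonds`, `card_edgeFinset_sdiff_dualBonds`,
`edgeConstEquiv` (edge-constant functions `≃ₗ` functions of the open dual cluster, via
`SimpleGraph.ConnectedComponent.lift`), **`finrank_dualCocycles_eq_clusterCount`**
(`dim_F W(ω) = k(ω•)`, the free cluster count of the tree's `clusterCount`),
**`rcWeight_dualBonds`** (`rcWeight_{dualGraph,p',q}^{free}(ω•) = dualWeight_{p',q}(ω)`) and
**`duality_plaquette_bond_three`** (Theorem 18 for `(3,2)`: `w_{p,q}(ω)(√q)^{b•(ω)} =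
C · rcWeight_{p*,q}(ω•)(√q)^{b₂(ω)}`). The balancing exponents `b₂ = giantTwo`, `b• = dualGiant` are
those of `PlaquetteRandomClusterDuality` (the identification of `b•` with the giant-loop rank of the
bond configuration `ω•` is that file's dictionary and is not re-proved here).

Everything in this file is PROVED; no named fact is introduced.
-/

open Finset Module

namespace Literature.MathematicalPhysics.QuantumFieldTheory

namespace PlaquetteRC

open LatticeForm

/-! ### Directions in dimension three -/

namespace Dual3

/-- The planes `{a < b}` of `ℤ³`. [cite: DuncanSchweinhart2025, §2.2 (the dual complex)] -/
abbrev Plane : Type := {p : Fin 3 × Fin 3 // p.1 < p.2}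

/-- The unique `3`-frame `{0 < 1 < 2}` of `ℤ³`. [cite: DuncanSchweinhart2025, §2.2] -/
abbrev Triple : Type := {t : Fin 3 × Fin 3 × Fin 3 // t.1 < t.2.1 ∧ t.2.1 < t.2.2}

/-- The direction normal to the plane `{a, b}`. [cite: DuncanSchweinhart2025, §2.2 (dual cells)] -/
def complDir (a b : Fin 3) : Fin 3 := if a ≠ 0 then 0 else if b ≠ 1 then 1 else 2

/-- `{0 < 1 < 2}` is sorted. [cite: DuncanSchweinhart2025, §2.2] -/
theorem top_sorted : ((0 : Fin 3), (1 : Fin 3), (2 : Fin 3)).1 < ((0 : Fin 3), (1 : Fin 3), (2 : Fin 3)).2.1 ∧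
    ((0 : Fin 3), (1 : Fin 3), (2 : Fin 3)).2.1 < ((0 : Fin 3), (1 : Fin 3), (2 : Fin 3)).2.2 := by decide

/-- The top frame. [cite: DuncanSchweinhart2025, §2.2] -/
def top : Triple := ⟨((0 : Fin 3), (1 : Fin 3), (2 : Fin 3)), top_sorted⟩

/-- There is only one `3`-frame in `ℤ³`. [cite: DuncanSchweinhart2025, §2.2] -/
theorem eq_top : ∀ T : Triple, T = top := by decide

/-- The incidence sign of the cube on its face in the plane `π`: `-1` for the middle plane `{0,2}`,
`+1` otherwise. [cite: DuncanSchweinhart2025, §2.1 (∂ of an i-plaquette)] -/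
def faceSign (π : Plane) : ℤ :=
  if π.1.1 < complDir π.1.1 π.1.2 ∧ complDir π.1.1 π.1.2 < π.1.2 then -1 else 1

/-- `faceSign² = 1`. [cite: DuncanSchweinhart2025, §2.1] -/
theorem faceSign_mul_self : ∀ π : Plane, faceSign π * faceSign π = 1 := by decide

/-- `complDir` is injective on planes. [cite: DuncanSchweinhart2025, §2.2] -/
theorem complDir_injective : ∀ π π' : Plane,
    complDir π.1.1 π.1.2 = complDir π'.1.1 π'.1.2 → π = π' := by decide

end Dual3

/-! ### `∂₃` on `𝕋³_L` in coordinates and the dual cocycles as edge-constant functions -/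

section Three

variable {L : ℕ} {F : Type*} [Field F]

open Dual3

/-- Point equations as translations. [folklore] -/
private theorem add_eq_iff_eq_sub_site₃ (y z v : Site 3 L) : y + v = z ↔ y = z - v :=
  eq_sub_iff_add_eq.symm

/-- The `3`-cells of `𝕋³_L` are the cubes: `Cell₃ 3 L ≃ Site 3 L`. [cite: DuncanSchweinhart2025, §2.2] -/
def cellEquiv₃ : Cell₃ 3 L ≃ Site 3 L where
  toFun c := c.1
  invFun x := (x, top)
  left_inv c := by
    obtain ⟨x, T⟩ := c
    simp only [eq_top T]
  right_inv x := rfl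

variable [NeZero L]

/-- **`∂₃` on `𝕋³_L`, explicitly**: the plaquette `(z; a<b)` is a face of the two cubes `z` and
`z - e_c`, `c` the normal direction, with opposite incidence signs `∓ faceSign`.
[cite: DuncanSchweinhart2025, §2.1 (∂ of an i-plaquette)] -/
theorem bd₃_apply_three (w : Cell₃ 3 L → F) (z : Site 3 L) (π : Plane) :
    bd₃ w (z, π) =
      (faceSign π : F) * (w (z - te (complDir π.1.1 π.1.2), top) - w (z, top)) := by
  classical
  obtain ⟨⟨a, b⟩, hab⟩ := π
  unfold bd₃
  rw [Fintype.sum_prod_type_right, Finset.sum_eq_single top (fun T _ hT => absurd (eq_top T) hT)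
    (fun h => absurd (Finset.mem_univ _) h)]
  fin_cases a <;> fin_cases b <;> simp (config := {decide := true}) at hab
  all_goals
    simp (config := {decide := true}) [top, complDir, faceSign, td₂, LatticeForm.ext, plaqInd,
      Prod.mk.injEq, add_eq_iff_eq_sub_site₃, mul_sub, Finset.sum_sub_distrib]
  all_goals ring

/-- `faceSign ≠ 0` in a field. [cite: DuncanSchweinhart2025, §2.1] -/
theorem faceSign_cast_ne_zero (π : Plane) : ((faceSign π : ℤ) : F) ≠ 0 := by
  intro h0
  have h1 : ((faceSign π * faceSign π : ℤ) : F) = 1 := by rw [faceSign_mul_self π, Int.cast_one]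
  rw [Int.cast_mul, h0, zero_mul] at h1
  exact zero_ne_one h1

/-- **Dual cocycles in `d = 3` are the cube functions constant across every closed plaquette.**
[cite: DuncanSchweinhart2025, §2.2 and Thm. 18 (proof; i = 2, d = 3: the dual cells of plaquettes are edges)] -/
theorem mem_dualCocycles_three {ω : Finset (Plaquette 3 L)} {w : Cell₃ 3 L → F} :
    w ∈ dualCocycles F ω ↔
      ∀ σ : Plaquette 3 L, σ ∉ ω → w (σ.1 - te (complDir σ.2.1.1 σ.2.1.2), top) = w (σ.1, top) := by
  rw [mem_dualCocycles]
  refine forall_congr' fun σ => forall_congr' fun _ => ?_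
  obtain ⟨z, π⟩ := σ
  rw [bd₃_apply_three, mul_eq_zero, or_iff_right (faceSign_cast_ne_zero π), sub_eq_zero]

end Three

/-! ### The dual graph of `𝕋³_L` (cubes joined across plaquettes) and the dual bond configuration -/

section DualGraph

variable {L : ℕ}

open Dual3 Literature.Probability.Percolation Literature.Probability.LatticeModels

/-- **The dual edge of a plaquette**: the bond between the two cubes `z - e_c` and `z` (labelled by
their base points) separated by the plaquette `(z; a<b)`, `c` its normal direction.
[cite: DuncanSchweinhart2025, §2.2 (the dual (d-i)-cell; d = 3, i = 2: an edge)] -/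
def dualEdge (σ : Plaquette 3 L) : Sym2 (Site 3 L) :=
  s(σ.1 - te (complDir σ.2.1.1 σ.2.1.2), σ.1)

/-- `e_c(c) = 1`. [folklore] -/
private theorem te_apply_self₃ (c : Fin 3) : (te c : Site 3 L) c = 1 := by
  dsimp only [te]
  rw [Pi.single_eq_same]

/-- `e_c(c') = 0` for `c' ≠ c`. [folklore] -/
private theorem te_apply_ne₃ {c c' : Fin 3} (h : c' ≠ c) : (te c : Site 3 L) c' = 0 := by
  dsimp only [te]
  rw [Pi.single_eq_of_ne h]

/-- For `L ≥ 2` a dual edge is a genuine edge (not a loop). [cite: DuncanSchweinhart2025, §2.2] -/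
theorem not_isDiag_dualEdge (hL : 2 ≤ L) (σ : Plaquette 3 L) : ¬(dualEdge σ).IsDiag := by
  haveI : Fact (1 < L) := ⟨by omega⟩
  rw [dualEdge, Sym2.mk_isDiag_iff, sub_eq_self]
  intro h
  have h1 := congrFun h (complDir σ.2.1.1 σ.2.1.2)
  rw [te_apply_self₃, Pi.zero_apply] at h1
  exact one_ne_zero h1

/-- **For `L ≥ 3` distinct plaquettes have distinct dual edges** (for `L = 2` the torus graph has
double edges and the simple-graph dual fails). [cite: DuncanSchweinhart2025, §2.2] -/
theorem dualEdge_injective (hL : 3 ≤ L) : Function.Injective (dualEdge (L := L)) := by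
  haveI : NeZero L := ⟨by omega⟩
  haveI : Fact (1 < L) := ⟨by omega⟩
  have h2 : (2 : ZMod L) ≠ 0 := by
    intro h
    have h' : ((2 : ℕ) : ZMod L) = 0 := by exact_mod_cast h
    rw [ZMod.natCast_eq_zero_iff] at h'
    have := Nat.le_of_dvd two_pos h'
    omega
  rintro ⟨z, π⟩ ⟨z', π'⟩ h
  rw [dualEdge, dualEdge, Sym2.eq_iff] at h
  rcases h with ⟨hA, hB⟩ | ⟨hA, hB⟩
  · simp only at hB
    subst hB
    have htc : (te (complDir π.1.1 π.1.2) : Site 3 L) = te (complDir π'.1.1 π'.1.2) :=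
      sub_right_injective hA
    have hcc : complDir π.1.1 π.1.2 = complDir π'.1.1 π'.1.2 := by
      by_contra hne
      have h1 := congrFun htc (complDir π.1.1 π.1.2)
      rw [te_apply_self₃, te_apply_ne₃ hne] at h1
      exact one_ne_zero h1
    exact Prod.ext rfl (complDir_injective π π' hcc)
  · exfalso
    simp only at hA hB
    -- `z - e_c = z'` and `z = z' - e_{c'}` force `e_c + e_{c'} = 0`
    have hsum : (te (complDir π.1.1 π.1.2) : Site 3 L) + te (complDir π'.1.1 π'.1.2) = 0 := by
      have : z = z - te (complDir π.1.1 π.1.2) - te (complDir π'.1.1 π'.1.2) := by rw [hA]; exact hB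
      have h' := congrArg (fun w => z - w) this
      simp only [sub_sub, sub_sub_cancel, sub_self] at h'
      exact h'.symm
    by_cases hcc : complDir π.1.1 π.1.2 = complDir π'.1.1 π'.1.2
    · have h1 := congrFun hsum (complDir π.1.1 π.1.2)
      rw [Pi.add_apply, ← hcc, te_apply_self₃, Pi.zero_apply] at h1
      exact h2 (by rw [← h1]; norm_num)
    · have h1 := congrFun hsum (complDir π.1.1 π.1.2)
      rw [Pi.add_apply, te_apply_self₃, te_apply_ne₃ hcc, add_zero, Pi.zero_apply] at h1
      exact one_ne_zero h1

variable [NeZero L]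

/-- **The dual bond configuration** `ω• = {σ• : σ closed}` (open dual bonds = duals of closed
plaquettes). [cite: DuncanSchweinhart2025, §4.3 (ω•) and Thm. 18] -/
def dualBonds (ω : Finset (Plaquette 3 L)) : Finset (Sym2 (Site 3 L)) := ωᶜ.image dualEdge

/-- **The dual graph of `𝕋³_L`**: cubes adjacent across plaquettes — again the nearest-neighbour
`3`-torus. [cite: DuncanSchweinhart2025, §2.2 (the dual complex of 𝕋^d_N)] -/
def dualGraph : SimpleGraph (Site 3 L) :=
  SimpleGraph.fromEdgeSet ↑((Finset.univ : Finset (Plaquette 3 L)).image dualEdge)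

/-- `|ω•| = |ωᶜ|` (`L ≥ 3`). [cite: DuncanSchweinhart2025, §4.3] -/
theorem card_dualBonds (hL : 3 ≤ L) (ω : Finset (Plaquette 3 L)) : (dualBonds ω).card = ωᶜ.card :=
  Finset.card_image_of_injective _ (dualEdge_injective hL)

/-- The edges of the dual graph are all dual edges (`L ≥ 2`: none is a loop). [cite: DuncanSchweinhart2025, §2.2] -/
theorem edgeFinset_dualGraph [DecidableRel (dualGraph (L := L)).Adj] (hL : 2 ≤ L) :
    (dualGraph (L := L)).edgeFinset = (Finset.univ : Finset (Plaquette 3 L)).image dualEdge := by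
  ext e
  rw [SimpleGraph.mem_edgeFinset, dualGraph, SimpleGraph.edgeSet_fromEdgeSet, Set.mem_sdiff,
    Finset.mem_coe]
  constructor
  · exact fun h => h.1
  · intro h
    refine ⟨h, ?_⟩
    obtain ⟨σ, -, rfl⟩ := Finset.mem_image.mp h
    exact not_isDiag_dualEdge hL σ

/-- **The closed dual bonds are the duals of the open plaquettes**: `|E(dual) ∖ ω•| = |ω|` (`L ≥ 3`).
[cite: DuncanSchweinhart2025, §4.3] -/
theorem card_edgeFinset_sdiff_dualBonds [DecidableRel (dualGraph (L := L)).Adj] (hL : 3 ≤ L)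
    (ω : Finset (Plaquette 3 L)) :
    ((dualGraph (L := L)).edgeFinset \ dualBonds ω).card = ω.card := by
  rw [edgeFinset_dualGraph (by omega), dualBonds,
    ← Finset.image_sdiff _ _ (dualEdge_injective hL), Finset.card_image_of_injective _
      (dualEdge_injective hL)]
  congr 1
  ext σ
  simp

end DualGraph

/-! ### `dim W(ω)` = the number of dual clusters -/

section Clusters

variable {L : ℕ} (F : Type*) [Field F]

open Dual3 Literature.Probability.Percolation Literature.Probability.LatticeModels

/-- The cube functions constant across every CLOSED plaquette (= along every open dual bond).
[cite: DuncanSchweinhart2025, Thm. 18 (proof; d = 3: Z⁰ of the dual bond configuration)] -/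
def edgeConst (ω : Finset (Plaquette 3 L)) : Submodule F (Site 3 L → F) where
  carrier := {f | ∀ σ : Plaquette 3 L, σ ∉ ω → f (σ.1 - te (complDir σ.2.1.1 σ.2.1.2)) = f σ.1}
  add_mem' := by
    intro f g hf hg σ hσ
    simp only [Pi.add_apply, hf σ hσ, hg σ hσ]
  zero_mem' := by
    intro σ _
    rfl
  smul_mem' := by
    intro r f hf σ hσ
    simp only [Pi.smul_apply, hf σ hσ]

/-- Membership in `edgeConst`. [cite: DuncanSchweinhart2025, Thm. 18 (proof)] -/
theorem mem_edgeConst {ω : Finset (Plaquette 3 L)} {f : Site 3 L → F} :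
    f ∈ edgeConst F ω ↔
      ∀ σ : Plaquette 3 L, σ ∉ ω → f (σ.1 - te (complDir σ.2.1.1 σ.2.1.2)) = f σ.1 := Iff.rfl

variable [NeZero L]

/-- `W(ω) ≅ edgeConst(ω)` under `Cell₃ 3 L ≃ Site 3 L`. [cite: DuncanSchweinhart2025, Thm. 18 (proof)] -/
theorem map_dualCocycles_three (ω : Finset (Plaquette 3 L)) :
    (dualCocycles F ω).map
        ((LinearEquiv.funCongrLeft F F (cellEquiv₃ (L := L)).symm :
            (Cell₃ 3 L → F) ≃ₗ[F] (Site 3 L → F)) : (Cell₃ 3 L → F) →ₗ[F] (Site 3 L → F)) =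
      edgeConst F ω := by
  ext f
  rw [Submodule.mem_map, mem_edgeConst]
  constructor
  · rintro ⟨w, hw, rfl⟩
    rw [mem_dualCocycles_three] at hw
    intro σ hσ
    simpa [LinearEquiv.funCongrLeft_apply, LinearMap.funLeft_apply, cellEquiv₃] using hw σ hσ
  · intro hf
    refine ⟨LinearEquiv.funCongrLeft F F (cellEquiv₃ (L := L)) f, ?_, ?_⟩
    · rw [mem_dualCocycles_three]
      intro σ hσ
      simpa [LinearEquiv.funCongrLeft_apply, LinearMap.funLeft_apply, cellEquiv₃] using hf σ hσ
    · funext x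
      simp [LinearEquiv.funCongrLeft_apply, LinearMap.funLeft_apply, cellEquiv₃]

/-- Adjacent cubes of the open dual graph carry equal values of an edge-constant function.
[cite: DuncanSchweinhart2025, Thm. 18 (proof)] -/
theorem eq_of_adj_openGraph_dualBonds {ω : Finset (Plaquette 3 L)} {f : Site 3 L → F}
    (hf : f ∈ edgeConst F ω) {v u : Site 3 L}
    (h : (openGraph (↑(dualBonds ω) : BondConfig (Site 3 L))).Adj v u) : f v = f u := by
  rw [openGraph_adj, Finset.mem_coe, dualBonds, Finset.mem_image] at h
  obtain ⟨⟨σ, hσ, hvu⟩, -⟩ := h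
  rw [Finset.mem_compl] at hσ
  have hc := hf σ hσ
  rw [dualEdge, Sym2.eq_iff] at hvu
  rcases hvu with ⟨rfl, rfl⟩ | ⟨rfl, rfl⟩
  · exact hc
  · exact hc.symm

/-- … hence along any walk. [cite: DuncanSchweinhart2025, Thm. 18 (proof)] -/
theorem eq_of_walk_openGraph_dualBonds {ω : Finset (Plaquette 3 L)} {f : Site 3 L → F}
    (hf : f ∈ edgeConst F ω) {v u : Site 3 L}
    (p : (openGraph (↑(dualBonds ω) : BondConfig (Site 3 L))).Walk v u) : f v = f u := by
  induction p with
  | nil => rfl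
  | cons hadj _ ih => exact (eq_of_adj_openGraph_dualBonds F hf hadj).trans ih

/-- **Edge-constant functions = functions of the dual cluster**: `edgeConst(ω) ≅ F^{clusters(ω•)}`.
[cite: DuncanSchweinhart2025, Thm. 18 (proof; d = 3: dim Z⁰(P•(ω•)) = # clusters)] -/
noncomputable def edgeConstEquiv (ω : Finset (Plaquette 3 L)) :
    edgeConst F ω ≃ₗ[F]
      ((openGraph (↑(dualBonds ω) : BondConfig (Site 3 L))).ConnectedComponent → F) where
  toFun f c := SimpleGraph.ConnectedComponent.lift (fun v => f.1 v)
    (fun _ _ p _ => eq_of_walk_openGraph_dualBonds F f.2 p) c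
  invFun g := ⟨fun v => g ((openGraph (↑(dualBonds ω) : BondConfig (Site 3 L))).connectedComponentMk v),
    by
      intro σ hσ
      simp only
      congr 1
      by_cases h : σ.1 - te (complDir σ.2.1.1 σ.2.1.2) = σ.1
      · rw [h]
      · refine SimpleGraph.ConnectedComponent.sound (SimpleGraph.Adj.reachable ?_)
        rw [openGraph_adj, Finset.mem_coe, dualBonds, Finset.mem_image]
        exact ⟨⟨σ, Finset.mem_compl.mpr hσ, rfl⟩, h⟩⟩
  map_add' f g := by
    funext c
    induction c using SimpleGraph.ConnectedComponent.ind with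
    | h v => simp
  map_smul' r f := by
    funext c
    induction c using SimpleGraph.ConnectedComponent.ind with
    | h v => simp
  left_inv f := by
    apply Subtype.ext
    funext v
    simp
  right_inv g := by
    funext c
    induction c using SimpleGraph.ConnectedComponent.ind with
    | h v => simp

/-- **`dim_F W(ω)` = the number of open clusters of the dual bond configuration `ω•`** (free count).
[cite: DuncanSchweinhart2025, Thm. 18 (proof; d = 3) and §4.3] -/
theorem finrank_dualCocycles_eq_clusterCount (ω : Finset (Plaquette 3 L)) :
    finrank F (dualCocycles F ω) = clusterCount (↑(dualBonds ω) : BondConfig (Site 3 L)) ∅ := by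
  haveI := Fintype.ofFinite (openGraph (↑(dualBonds ω) : BondConfig (Site 3 L))).ConnectedComponent
  rw [← LinearEquiv.finrank_map_eq (LinearEquiv.funCongrLeft F F (cellEquiv₃ (L := L)).symm)
      (dualCocycles F ω), map_dualCocycles_three, (edgeConstEquiv F ω).finrank_eq,
    Module.finrank_fintype_fun_eq_card, clusterCount, wired_empty, sup_bot_eq, Nat.card_eq_fintype_card]

end Clusters

/-! ### Theorem 18 for `(d, i) = (3, 2)`: the plaquette random-cluster model on `𝕋³_L` is dual to
the (bond) random-cluster model on the dual torus graph -/

section Wegner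

variable {L : ℕ} [NeZero L] (F : Type*) [Field F]

open Dual3 Literature.Probability.Percolation Literature.Probability.LatticeModels

/-- **The dictionary weight is the random-cluster weight of the dual bond configuration** (`L ≥ 3`):
`rcWeight_{dual graph, p', q}^{free}(ω•) = p'^{|ωᶜ|} (1-p')^{|ω|} q^{k(ω•)} = dualWeight_{p',q}(ω)`,
with `k(ω•) = dim_F W(ω)`. [cite: DuncanSchweinhart2025, Thm. 18 (d = 3, i = 2) and §4.3] -/
theorem rcWeight_dualBonds [DecidableRel (dualGraph (L := L)).Adj] (hL : 3 ≤ L) (p' q : ℝ)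
    (ω : Finset (Plaquette 3 L)) :
    rcWeight (dualGraph (L := L)) p' q ∅ (dualBonds ω) = dualWeight F p' q ω := by
  unfold rcWeight dualWeight
  rw [card_dualBonds hL, card_edgeFinset_sdiff_dualBonds hL, finrank_dualCocycles_eq_clusterCount]

/-- **Duncan–Schweinhart Theorem 18 for `(d, i) = (3, 2)`, literally: the plaquette random-cluster
model on `𝕋³_L` (`L ≥ 3`) is dual to the FK random-cluster model (`rcWeight` of the tree, free
boundary) on the dual torus graph.** For `p ∈ (0,1)`, `q > 0` there is `C = C(p,q,L) > 0` with
`w_{p,q}(ω) (√q)^{b•(ω)} = C · rcWeight_{p*,q}(ω•) (√q)^{b₂(ω)}` for every plaquette configuration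
`ω`, `p* = (1-p)q/((1-p)q + p)`, `ω• = dualBonds ω` the open dual bonds (duals of the CLOSED
plaquettes), `b₂ = giantTwo` (rank of `H₂(P(ω)) → H₂(𝕋³)`) and `b• = dualGiant` the balancing ranks
of the companion file (there `b•` is defined in primal coordinates; its reading as the giant-loop rank
`b₁` of the bond configuration `ω•` is the dictionary of `PlaquetteRandomClusterDuality`, not
re-proved here). With Theorem 5 (`𝔼_{ν_β} W_γ = μ_{1-e^{-β},q}(V_γ)`, prime `q`,
`PottsGaugeWilsonLoopTopology`) this is the FK form of the duality "`ℤ_q` lattice gauge theory in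
three dimensions ↔ `q`-state Potts model on the dual lattice" on the finite torus.
[cite: DuncanSchweinhart2025, Thm. 18 and §4.3 (p*)] -/
theorem duality_plaquette_bond_three [DecidableRel (dualGraph (L := L)).Adj] (hL : 3 ≤ L)
    {p q : ℝ} (hp : p ∈ Set.Ioo (0 : ℝ) 1) (hq : 0 < q) :
    ∃ C : ℝ, 0 < C ∧ ∀ ω : Finset (Plaquette 3 L),
      weight F p q ω * Real.sqrt q ^ dualGiant F ω =
        C * (rcWeight (dualGraph (L := L)) (dualParam p q) q ∅ (dualBonds ω) *
          Real.sqrt q ^ giantTwo F ω) := by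
  obtain ⟨C, hC, h⟩ := duality_balanced_weight (d := 3) (L := L) F hp hq
  exact ⟨C, hC, fun ω => by rw [rcWeight_dualBonds F hL]; exact h ω⟩

end Wegner

end PlaquetteRC

end Literature.MathematicalPhysics.QuantumFieldTheory
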